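import Literature.NumberTheory.Rogawski1990.ArchTransfFamilyJumpPartners   -- PART 2b (LH7-p02 (g2)): `hasOneSidedJump_resolvedSum`, `tendsto_twisted_slotPerm_add_smul_nrm`; brings PART 2a, ★ Resolved (LH3-p04 (g3)), ★ A1 (F0P3a-p09 (g5))
import HarnessLib

/-!
# (I₃) for the candidate transfer family — PART 2c: THE ORDER-0 JUMP OF `transfFam` AT A COVERED WALL IS `2·jc′ S w₀ 0 2 ·` ITS CAYLEY VALUE
# (Shelstad 1979 Lemma 4.3, Prop. 4.5, Thm. 4.7 (IIIb); Bouaziz 1994 §3.2 (I₃), Rem. 2 p. 594; Rogawski 1990 §4.3 (4.3.1), §8.2)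

Topic `NumberTheory/Rogawski1990`; namespace `Literature.NumberTheory.Rogawski1990`.  THEOREMS ONLY (no `def`, no instance, no notation, no axiom, no named fact, no `sorry`).
Cell `pub/hodgecm-mathlib`, line LH3 (closer stub `stub_N9`, crux H413 = `stmt-HodgeConjecture-24833`), organ **O-L2 (I₃-TRANSF)**, ED. 1 = order `0` at the `G`-semiregular
covered wall points (LH3-plan (g3) DEALER BOARD g3 #1 (iv), RULING #2; author LH7-p02 (g2)).  HONEST LABEL: HC_CM is proved only modulo the 7 printed citations (2 remaining:
hLiu418 = `stmt-HodgeConjecture-24832`, h413 = `stmt-HodgeConjecture-24833`) until rung 0 closes; count-neutral.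

THE MATHEMATICS (Shelstad's proof of Thm. 4.7 (IIIb), p. 31, in the tree's coordinates).  Let `S` be an admissible `H`-chart, `w₀ ∉ S` a COVERED wall (`w₀ ∈ splitChartPlaces`),
`s` a point ON the wall (`s w₀ 0 = s w₀ 2`) which is `G`-semiregular (`e^{is_{w₀1}} ≠ e^{is_{w₀0}}`, `G`-regular at the other compact places, `x_v ≠ 0` at the split ones), and
`c_ν = s + ν • nrm w₀` the normal curve (in `RegG S` for small `ν ≠ 0`, PART 2a §3).  By ★ `transfFamReg_eq_unit_mul_sum` (LH3-p04 (g3), on ★ A1 of F0P3a-p09 (g5)),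
`transfFam S c_ν = w_S · Ũ_k(c_ν) · Σ_{ρ ∈ partnerPerms S} κ_ρ · 'F_S(ρ·c_ν)` with `'F_S = archERhoG S · F S`, `Ũ_k` ENTIRE and `κ_ρ = K_ρ · Π_w sign ρ_w`.  Write each partner as
`ρ = ρ′·σ` (`ρ′ = update ρ w₀ 1 ∈ partnerPerms (insert w₀ S)`, `σ = ρ w₀ ∈ S₃`); `p′ = ρ′·s` is again a semiregular wall point and `ρ·c_ν = σ·(p′ + ν • nrm w₀)` (PART 2a §2).  The six `σ`
(PART 2b §4, `perm_fin_three_eq`): `σ = 1` reads `g(ν) = 'F_S(p′ + ν•nrm w₀)`, whose jump is `J = jc′ S w₀ 0 2 · 'F_{S″}(cayPt w₀ p′)` by HC's (I₃) at order `0` (★ `ArchHcJump.order_zero`,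
`S″ = insert w₀ S`); `σ = (02)` reads `g(−ν)` (jump `−J`); `σ = (01)` reads `'F_S(swap₀₁(p′+ν•nrm)) = −g(ν)` (the compact reflection: (W) + the ALTERNATION of the Weyl
denominator ★ `archERhoG_mul_archRG_slotPerm`; jump `−J`); `σ = (012)` reads `−g(−ν)` (jump `+J`); the two `σ` with `σ⁻¹1 = 2` put the colliding pair on the COMPACT slots `(0,1)`,
where `'F_S` is continuous by (I₁) (★ `InRegG` keeps compact walls): jump `0`.  With `κ_{ρ′σ} = sign σ · κ_{ρ′}` on the four jumping classes (the slot signs `0, 1` agree at a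
covered place) every one of them contributes `+κ_{ρ′}·J(ρ′)`, so the total jump is `w_S·Ũ^S_k(s)·4·jc′₀₂·Σ_{ρ′} κ_{ρ′}'F_{S″}(ρ′·q)`, `q = cayPt w₀ s` (PART 2b §5: the re-indexing
`Σ_ρ = Σ_{ρ′} Σ_σ` and `#{σ | σ⁻¹1 ≠ 2} = 4`).  On the Cayley side `q` is TAME for `S″` (real wall at `w₀`, `G`-regular elsewhere), so ★ LH3-p04's mechanism gives
`transfFam S″ q = w_{S″}·Ũ^{S″}_k(q)·Σ_{ρ′} κ_{ρ′}'F_{S″}(ρ′·q)` (§6); finally `w_S = w_{S″}∕2` (`w₀` indefinite) and `Ũ^S_k(s) = Ũ^{S″}_k(q)` (both `w₀`-factors are `e^{i(2k+1)θ}`),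
whence **`lim_{0⁺} − lim_{0⁻} = 2 · jc′ S w₀ 0 2 · transfFam S″ (cayPt w₀ s)`** (§7 `transfFam_hasOneSidedJump_order_zero`): the `H`-side constant is `Θ·jc′₀₂` with `Θ = 2`
(★ `AgreesOnAdmissibleCoveredSlots`), re-derived here from first principles (four equal partner jumps × the class weight `½`).  No `ArchBzSmoothBounded` hypothesis is needed at
order `0`: the Cayley value is read through (I₁) at a tame point.  §8: the ZERO BRANCHES (inadmissible `S`; uncovered `w₀`, i.e. a definite place of the house frame — both
sides vanish) and the head `transfFam_hasOneSidedJump_order_zero_all` for EVERY compact wall `w₀ ∉ S` of EVERY chart `S`.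

## References
* [Shelstad1979] D. Shelstad, *Characters and inner forms of a quasi-split group over ℝ*, Compositio Math. 39 (1979), §4: Lemma 4.2 p. 23, Lemma 4.3 p. 25, Prop. 4.5 p. 26,
  Thm. 4.7 (IIIb) p. 31.
* [Bouaziz1994IntegralesOrbitales] A. Bouaziz, *Intégrales orbitales sur les groupes de Lie réductifs*, Ann. Sci. ÉNS 27 (1994), §3.2 (I₁)–(I₃) pp. 579–580, Rem. 2 p. 594.
* [Rogawski1990] J. D. Rogawski, *Automorphic Representations of Unitary Groups in Three Variables* (1990), §4.3 (4.3.1) p. 43, §8.2 pp. 119–123, §14.3 pp. 233–234.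
* [Varadarajan1977] V. S. Varadarajan, *Harmonic Analysis on Real Reductive Groups*, LNM 576 (1977), Part I §1.12.
-/

set_option autoImplicit false

noncomputable section

open NumberField NumberField.InfinitePlace Complex Set Filter Topology Equiv Finset
open scoped Classical Real ContDiff
open Literature.NumberTheory.Automorphic Literature.NumberTheory.Automorphic.UnitaryGroup Literature.NumberTheory.Automorphic.ArchCartan
open Literature.NumberTheory.Automorphic.Shelstad1979.StableOrbitalIntegrals
open Literature.NumberTheory.GaloisRepresentations

namespace Literature.NumberTheory.Rogawski1990

/-! ## §6 The Cayley side: the class weight halves, the unit `Ũ_k` matches, `transfFam S″ (cayPt)` is the resolved sum (tame point) -/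

section Cayley

variable (L : Type) [Field L] [NumberField L] [IsCMField L] (α : Fin 3 → L) (μ : HeckeCharacter L)

omit [IsCMField L] in
/-- **The class weight halves across a covered wall**: `partnerWeight S = ½ · partnerWeight (insert w₀ S)` for `w₀ ∉ S` indefinite (`S₃` at an indefinite compact place counts each
class twice). [cite: Rogawski1990, §4.3 (4.3.1) p. 43; §14.2 p. 232] -/
theorem partnerWeight_eq_inv_two_mul_insert {S : Finset {w : InfinitePlace L // IsComplex w}} {w₀ : {w : InfinitePlace L // IsComplex w}} (hw₀ : w₀ ∉ S)
    (hind : IsIndefiniteAt (slotSign L α) w₀) : partnerWeight L α S = 2⁻¹ * partnerWeight L α (insert w₀ S) := by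
  unfold partnerWeight
  have hset : Finset.univ \ S = insert w₀ (Finset.univ \ insert w₀ S) := by
    ext w
    simp only [Finset.mem_sdiff, Finset.mem_univ, true_and, Finset.mem_insert]
    by_cases h : w = w₀
    · subst h; simp [hw₀]
    · simp [h]
  rw [hset, Finset.prod_insert (by simp), if_pos hind]

omit [NumberField L] [IsCMField L] in
/-- **The unit `Ũ_k` matches across the Cayley transform**: at a wall point `s` (`s_{w₀0} = s_{w₀2}`, `w₀ ∉ S`) the `S`-unit and the `(insert w₀ S)`-unit at `cayPt w₀ s` agree — both
`w₀`-factors are `e^{i(2k+1)θ}`. [cite: Rogawski1990, §4.9 p. 55; §8.2 p. 119] [cite: Shelstad1979, §4 p. 25] -/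
theorem unit_eq_unit_insert_cayPt {W : Type*} [Fintype W] [DecidableEq W] (S : Finset W) (k : W → ℤ) {w₀ : W} (hw₀ : w₀ ∉ S) {s : W → Fin 3 → ℝ}
    (hs02 : s w₀ 0 = s w₀ 2) :
    (∏ w : W, (if w ∈ S then Complex.exp (((2 * k w + 1 : ℤ) : ℂ) * ((s w 2 : ℂ) * I))
        else (((Circle.exp (s w 0) : ℂ) * Circle.exp (s w 2)) ^ (k w)) * (Circle.exp (s w 2) : ℂ))) =
      ∏ w : W, (if w ∈ insert w₀ S then Complex.exp (((2 * k w + 1 : ℤ) : ℂ) * (((cayPt w₀ s) w 2 : ℂ) * I))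
        else (((Circle.exp ((cayPt w₀ s) w 0) : ℂ) * Circle.exp ((cayPt w₀ s) w 2)) ^ (k w)) * (Circle.exp ((cayPt w₀ s) w 2) : ℂ)) := by
  refine Finset.prod_congr rfl fun w _ => ?_
  by_cases hw : w = w₀
  · subst hw
    rw [if_neg hw₀, if_pos (Finset.mem_insert_self w S), cayPt_apply_self]
    simp only [Matrix.cons_val_two, Matrix.tail_cons, Matrix.head_cons]
    rw [hs02, add_self_div_two, Complex.exp_int_mul, Circle.coe_exp]
    have hz : Complex.exp ((s w 2 : ℂ) * I) ≠ 0 := Complex.exp_ne_zero _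
    rw [zpow_add₀ hz, zpow_one, zpow_mul, zpow_two]
  · have hmem : (w ∈ insert w₀ S) ↔ (w ∈ S) := by simp [Finset.mem_insert, hw]
    simp only [hmem, cayPt_apply_of_ne hw]

/-- **THE CAYLEY VALUE — `transfFam` at a TAME point of `InRegS S` is the resolved sum** `w_S · Ũ_k(q) · Σ_ρ κ_ρ · 'F_S(ρ·q)` (★ LH3-p04's mechanism: `transfFamReg = Φ_k` on the dense
open `RegG S`, `Φ_k` continuous at `q`, `extendFrom` agrees).  Applies to the Cayley point `cayPt w₀ s` of a `G`-semiregular covered wall point (real wall at `w₀`, `G`-regular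
elsewhere). [cite: Bouaziz1994IntegralesOrbitales, §3.2 (I₁)–(I₂) p. 579; Rem. 2 p. 594] [cite: Rogawski1990, §4.3 (4.3.1) p. 43] [cite: Varadarajan1977, Part I §1.12] -/
theorem transfFam_eq_resolvedSum_of_tame {S : Finset {w : InfinitePlace L // IsComplex w}} (hS : ∀ w ∈ S, w ∈ splitChartPlaces L α)
    (F : Finset {w : InfinitePlace L // IsComplex w} → ({w : InfinitePlace L // IsComplex w} → Fin 3 → ℝ) → ℂ) (hI1 : ContDiffOn ℝ ∞ (F S) (InRegG (slotSign L α) S))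
    (k : {w : InfinitePlace L // IsComplex w} → ℤ)
    (hk : ∀ c : {w : InfinitePlace L // IsComplex w} → Fin 3 → ℝ,
      archTau L (endoTorus L S c) μ * (archWeylRatio L (endoTorus L S c) : ℂ) =
        ∏ w : {w : InfinitePlace L // IsComplex w},
          -(((((if w ∈ S then boostEig (c w) else fun i => (Circle.exp (c w i) : ℂ)) 0) * ((if w ∈ S then boostEig (c w) else fun i => (Circle.exp (c w i) : ℂ)) 2)) ^ (k w)) *
              ((((if w ∈ S then boostEig (c w) else fun i => (Circle.exp (c w i) : ℂ)) 1) - ((if w ∈ S then boostEig (c w) else fun i => (Circle.exp (c w i) : ℂ)) 0)) *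
                (((if w ∈ S then boostEig (c w) else fun i => (Circle.exp (c w i) : ℂ)) 1) - ((if w ∈ S then boostEig (c w) else fun i => (Circle.exp (c w i) : ℂ)) 2))) /
            ((if w ∈ S then boostEig (c w) else fun i => (Circle.exp (c w i) : ℂ)) 1)))
    {q : {w : InfinitePlace L // IsComplex w} → Fin 3 → ℝ} (hq : q ∈ InRegS S) (htame : ∀ ρ ∈ partnerPerms S, slotPerm ρ q ∈ InRegG (slotSign L α) S) :
    transfFam L α μ F S q =
      (partnerWeight L α S *
        ∏ w : {w : InfinitePlace L // IsComplex w}, (if w ∈ S then Complex.exp (((2 * k w + 1 : ℤ) : ℂ) * ((q w 2 : ℂ) * I))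
          else (((Circle.exp (q w 0) : ℂ) * Circle.exp (q w 2)) ^ (k w)) * (Circle.exp (q w 2) : ℂ))) *
      ∑ ρ ∈ partnerPerms S,
        (((∏ w : {w : InfinitePlace L // IsComplex w},
            ((SignType.sign ((w.1.embedding (α (lineOf (formSign L α w) ((ρ w).symm 1)))).re) : ℤ) * archMajoritySign L (Matrix.diagonal α) w) : ℤ) : ℂ) *
          ∏ w : {w : InfinitePlace L // IsComplex w}, (Equiv.Perm.sign (ρ w) : ℂ)) *
        (archERhoG S (slotPerm ρ q) * F S (slotPerm ρ q)) := by
  by_cases hqR : q ∈ RegG S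
  · rw [transfFam_of_mem_regG L α μ F S hqR]
    exact transfFamReg_eq_unit_mul_sum L α μ hS F k hk hqR
  · rw [transfFam_of_mem_inRegS_of_not_mem_regG L α μ F S hq hqR]
    have hV : IsOpen {c : {w : InfinitePlace L // IsComplex w} → Fin 3 → ℝ | ∀ ρ ∈ partnerPerms S, slotPerm ρ c ∈ InRegG (slotSign L α) S} :=
      isOpen_setOf_forall_slotPerm_mem_inRegG (slotSign L α) S
    have hcont := ((contDiffOn_resolvedSum L α S F k hI1).continuousOn q htame).continuousAt (hV.mem_nhds htame)
    refine extendFrom_eq (by rw [(dense_regG S).closure_eq]; exact Set.mem_univ q) ?_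
    refine (hcont.tendsto.mono_left nhdsWithin_le_nhds).congr' (eventually_of_mem self_mem_nhdsWithin fun y hy => ?_)
    exact (transfFamReg_eq_unit_mul_sum L α μ hS F k hk hy).symm

end Cayley

/-! ## §7 THE ORDER-0 JUMP OF `transfFam` AT A COVERED WALL -/

section Main

variable (L : Type) [Field L] [NumberField L] [IsCMField L] (α : Fin 3 → L) (μ : HeckeCharacter L)

/-- **(I₃) AT ORDER `0` FOR THE CANDIDATE TRANSFER FAMILY — `d = 2`.**  House frame `α_i ≠ 0`, `μ`-guard `hμω`; `S` an ADMISSIBLE `H`-chart, `w₀ ∉ S` a COVERED wall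
(`w₀ ∈ splitChartPlaces L α`), `s` a `G`-SEMIREGULAR point of the wall (`s_{w₀0} = s_{w₀2}`, `e^{is_{w₀1}} ≠ e^{is_{w₀0}}`, `G`-regular at the other compact places, off the real
walls at the split ones), `F ∈ ArchHCSpaceG (slotSign L α) jc′`.  Then along the normal curve `ν ↦ transfFam L α μ F S (s + ν • nrm w₀)` both one-sided limits at `ν = 0` exist and
**`lim_{0⁺} − lim_{0⁻} = 2 · jc′ S w₀ 0 2 · transfFam L α μ F (insert w₀ S) (cayPt w₀ s)`** — Shelstad's (IIIb) `2i·Φ^{T_s}`, Bouaziz's `d(s) = 2`, with the `H`-side constant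
`jcH S w₀ = 2·jc′ S w₀ 0 2` of ★ `AgreesOnAdmissibleCoveredSlots` DERIVED (four jumping partner classes with equal contributions × the class weight `½`).  No smoothness hypothesis
on `transfFam` is used: the Cayley value is read through (I₁) at the tame point `cayPt w₀ s`. [cite: Shelstad1979, Thm. 4.7 (IIIb) p. 31; Lemma 4.3 p. 25; Prop. 4.5 p. 26]
[cite: Bouaziz1994IntegralesOrbitales, §3.2 (I₃) p. 580; Rem. 2 p. 594] [cite: Rogawski1990, §4.3 (4.3.1) p. 43; §8.2 pp. 119–123] -/
theorem transfFam_hasOneSidedJump_order_zero (hα : ∀ i, α i ≠ 0)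
    (hμω : ∀ x : ideleGroup ↥(maximalRealSubfield L), μ (AdeleRing.ideleBaseChange (↥(maximalRealSubfield L)) L x) = quadraticHeckeCharCM L x)
    {S : Finset {w : InfinitePlace L // IsComplex w}} (hS : ∀ w ∈ S, w ∈ splitChartPlaces L α)
    {w₀ : {w : InfinitePlace L // IsComplex w}} (hw₀ : w₀ ∉ S) (hcov : w₀ ∈ splitChartPlaces L α)
    {jc' : Finset {w : InfinitePlace L // IsComplex w} → {w : InfinitePlace L // IsComplex w} → Fin 3 → Fin 3 → ℂ}
    {F : Finset {w : InfinitePlace L // IsComplex w} → ({w : InfinitePlace L // IsComplex w} → Fin 3 → ℝ) → ℂ} (hF : ArchHCSpaceG (slotSign L α) jc' F)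
    {s : {w : InfinitePlace L // IsComplex w} → Fin 3 → ℝ} (hs02 : s w₀ 0 = s w₀ 2) (hs1 : Circle.exp (s w₀ 1) ≠ Circle.exp (s w₀ 0))
    (hreg : ∀ v, v ∉ S → v ≠ w₀ → Function.Injective fun i : Fin 3 => Circle.exp (s v i)) (hx : ∀ v ∈ S, s v 0 ≠ 0) :
    HasOneSidedJump (fun ν : ℝ => transfFam L α μ F S (s + ν • nrm w₀)) (2 * jc' S w₀ 0 2 * transfFam L α μ F (insert w₀ S) (cayPt w₀ s)) := by
  obtain ⟨k, hk⟩ := exists_archTau_mul_archWeylRatio_endoTorus_eq L μ hμω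
  obtain ⟨-, hind⟩ := slotSign_zero_ne_two_of_mem_splitChartPlaces L α hα hcov
  have hS'' : ∀ w ∈ insert w₀ S, w ∈ splitChartPlaces L α := by
    intro w hw
    rcases Finset.mem_insert.1 hw with rfl | hw
    · exact hcov
    · exact hS w hw
  obtain ⟨hev, -⟩ := eventually_nhdsNE_mem_regG_add_smul_nrm hw₀ hs02 hs1 hreg hx
  -- the prefactor `w_S · Ũ_k` is continuous through `ν = 0`
  have hU : Tendsto (fun ν : ℝ => partnerWeight L α S *
      ∏ w : {w : InfinitePlace L // IsComplex w}, (if w ∈ S then Complex.exp (((2 * k w + 1 : ℤ) : ℂ) * (((s + ν • nrm w₀) w 2 : ℂ) * I))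
        else (((Circle.exp ((s + ν • nrm w₀) w 0) : ℂ) * Circle.exp ((s + ν • nrm w₀) w 2)) ^ (k w)) * (Circle.exp ((s + ν • nrm w₀) w 2) : ℂ)))
      (𝓝 (0 : ℝ))
      (𝓝 (partnerWeight L α S *
        ∏ w : {w : InfinitePlace L // IsComplex w}, (if w ∈ S then Complex.exp (((2 * k w + 1 : ℤ) : ℂ) * ((s w 2 : ℂ) * I))
          else (((Circle.exp (s w 0) : ℂ) * Circle.exp (s w 2)) ^ (k w)) * (Circle.exp (s w 2) : ℂ)))) := by
    have hc : Continuous fun ν : ℝ => s + ν • nrm w₀ := continuous_const.add (continuous_id.smul continuous_const)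
    have hcU : Continuous fun ν : ℝ => partnerWeight L α S *
        ∏ w : {w : InfinitePlace L // IsComplex w}, (if w ∈ S then Complex.exp (((2 * k w + 1 : ℤ) : ℂ) * (((s + ν • nrm w₀) w 2 : ℂ) * I))
          else (((Circle.exp ((s + ν • nrm w₀) w 0) : ℂ) * Circle.exp ((s + ν • nrm w₀) w 2)) ^ (k w)) * (Circle.exp ((s + ν • nrm w₀) w 2) : ℂ)) :=
      continuous_const.mul ((contDiff_unit S k).continuous.comp hc)
    have h := hcU.tendsto (0 : ℝ)
    simp only [zero_smul, add_zero] at h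
    exact h
  have hsum := hasOneSidedJump_resolvedSum L α hα hw₀ hcov hF hs02 hs1 hreg hx
  have hprod := hasOneSidedJump_mul_of_tendsto hU hsum
  have hmain : HasOneSidedJump (fun ν : ℝ => transfFam L α μ F S (s + ν • nrm w₀)) _ :=
    hasOneSidedJump_congr_eventuallyEq hprod (by
      filter_upwards [hev] with ν hν
      rw [transfFam_of_mem_regG L α μ F S hν, transfFamReg_eq_unit_mul_sum L α μ hS F k (hk S) hν])
  refine HasOneSidedJump.jump_congr hmain ?_
  -- the Cayley side: `cayPt w₀ s` is a tame point of `InRegS (insert w₀ S)`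
  have hq : cayPt w₀ s ∈ InRegS (insert w₀ S) := by
    refine (cayPt_mem_inRegS_insert_iff S w₀ s).2 fun w hw => ?_
    have hw' : w ≠ w₀ ∧ w ∉ S := by simpa [Finset.mem_insert, not_or] using hw
    exact fun h => (show (0 : Fin 3) ≠ 2 by decide) (hreg w hw'.2 hw'.1 h)
  have htame : ∀ ρ ∈ partnerPerms (insert w₀ S), slotPerm ρ (cayPt w₀ s) ∈ InRegG (slotSign L α) (insert w₀ S) := by
    refine forall_slotPerm_mem_inRegG_of_injective (slotSign L α) (insert w₀ S) fun w hw _ => ?_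
    have hw' : w ≠ w₀ ∧ w ∉ S := by simpa [Finset.mem_insert, not_or] using hw
    simp only [cayPt_apply_of_ne hw'.1]
    exact hreg w hw'.2 hw'.1
  rw [transfFam_eq_resolvedSum_of_tame L α μ hS'' F (hF.2.2.1 _).1 k (hk _) hq htame, partnerWeight_eq_inv_two_mul_insert L α hw₀ hind,
    unit_eq_unit_insert_cayPt S k hw₀ hs02]
  ring

end Main

/-! ## §8 The zero branches (inadmissible chart; uncovered wall) and the head for ALL compact walls of ALL charts -/

section Zero

variable (L : Type) [Field L] [NumberField L] [IsCMField L] (α : Fin 3 → L) (μ : HeckeCharacter L)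

/-- **Inadmissible chart**: if `S` has a place outside `splitChartPlaces`, then `transfFam S = 0` and `transfFam (insert w₀ S) = 0` (★ `transfFam_eq_zero_of_not_admissible`), so the
order-0 jump relation holds trivially (`0 = 2·jc′·0`). [cite: Rogawski1990, §4.3 (4.3.1) p. 43] [cite: Bouaziz1994IntegralesOrbitales, Rem. 2 p. 594] -/
theorem transfFam_hasOneSidedJump_order_zero_of_not_admissible {S : Finset {w : InfinitePlace L // IsComplex w}} (hS : ¬ ∀ w, w ∈ S → w ∈ splitChartPlaces L α)
    (w₀ : {w : InfinitePlace L // IsComplex w}) (jc' : Finset {w : InfinitePlace L // IsComplex w} → {w : InfinitePlace L // IsComplex w} → Fin 3 → Fin 3 → ℂ)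
    (F : Finset {w : InfinitePlace L // IsComplex w} → ({w : InfinitePlace L // IsComplex w} → Fin 3 → ℝ) → ℂ) (s : {w : InfinitePlace L // IsComplex w} → Fin 3 → ℝ) :
    HasOneSidedJump (fun ν : ℝ => transfFam L α μ F S (s + ν • nrm w₀)) (2 * jc' S w₀ 0 2 * transfFam L α μ F (insert w₀ S) (cayPt w₀ s)) := by
  have hS'' : ¬ ∀ w, w ∈ insert w₀ S → w ∈ splitChartPlaces L α := fun h => hS fun w hw => h w (Finset.mem_insert_of_mem hw)
  simp only [transfFam_eq_zero_of_not_admissible L α μ F hS, transfFam_eq_zero_of_not_admissible L α μ F hS'', mul_zero]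
  exact hasOneSidedJump_zero_of_tendsto tendsto_const_nhds

/-- **Uncovered wall** (admissible `S`, compact `w₀ ∉ S` OUTSIDE `splitChartPlaces`, i.e. a DEFINITE place of the house frame): every partner point of a `G`-semiregular wall point is
tame (all slot pairs at `w₀` are compact), so `transfFam S` read along the normal is CONTINUOUS through `ν = 0` (jump `0`), while `insert w₀ S` is inadmissible, so the Cayley side is
`0` too. [cite: Rogawski1990, §14.2 p. 232; §4.3 (4.3.1) p. 43] [cite: Shelstad1979, §4 p. 23] -/
theorem transfFam_hasOneSidedJump_order_zero_of_not_mem_splitChartPlaces (hα : ∀ i, α i ≠ 0)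
    (hreal : ∀ (w : {w : InfinitePlace L // IsComplex w}) (i : Fin 3), (w.1.embedding (α i)).im = 0)
    (hμω : ∀ x : ideleGroup ↥(maximalRealSubfield L), μ (AdeleRing.ideleBaseChange (↥(maximalRealSubfield L)) L x) = quadraticHeckeCharCM L x)
    {S : Finset {w : InfinitePlace L // IsComplex w}} (hS : ∀ w ∈ S, w ∈ splitChartPlaces L α)
    {w₀ : {w : InfinitePlace L // IsComplex w}} (hw₀ : w₀ ∉ S) (hcov : w₀ ∉ splitChartPlaces L α)
    {jc' : Finset {w : InfinitePlace L // IsComplex w} → {w : InfinitePlace L // IsComplex w} → Fin 3 → Fin 3 → ℂ}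
    {F : Finset {w : InfinitePlace L // IsComplex w} → ({w : InfinitePlace L // IsComplex w} → Fin 3 → ℝ) → ℂ} (hF : ArchHCSpaceG (slotSign L α) jc' F)
    {s : {w : InfinitePlace L // IsComplex w} → Fin 3 → ℝ} (hs02 : s w₀ 0 = s w₀ 2) (hs1 : Circle.exp (s w₀ 1) ≠ Circle.exp (s w₀ 0))
    (hreg : ∀ v, v ∉ S → v ≠ w₀ → Function.Injective fun i : Fin 3 => Circle.exp (s v i)) (hx : ∀ v ∈ S, s v 0 ≠ 0) :
    HasOneSidedJump (fun ν : ℝ => transfFam L α μ F S (s + ν • nrm w₀)) (2 * jc' S w₀ 0 2 * transfFam L α μ F (insert w₀ S) (cayPt w₀ s)) := by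
  obtain ⟨k, hk⟩ := exists_archTau_mul_archWeylRatio_endoTorus_eq L μ hμω
  -- the Cayley side vanishes: `insert w₀ S` is inadmissible
  have hS'' : ¬ ∀ w, w ∈ insert w₀ S → w ∈ splitChartPlaces L α := fun h => hcov (h w₀ (Finset.mem_insert_self w₀ S))
  rw [transfFam_eq_zero_of_not_admissible L α μ F hS'', mul_zero]
  -- the place `w₀` is definite for `slotSign`
  have hdef : ¬ IsIndefiniteAt (slotSign L α) w₀ := by
    intro hind
    refine hcov (mem_splitChartPlaces_of_frame hα (hreal w₀) ?_)
    rintro ⟨h01, h12⟩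
    have hall : ∀ i, formSign L α w₀ i = formSign L α w₀ 0 := by
      intro i; fin_cases i
      · rfl
      · exact h01.symm
      · exact h12.symm.trans h01.symm
    exact hind ⟨(hall _).trans (hall _).symm, (hall _).trans (hall _).symm⟩
  -- every partner point of `s` is tame
  have htame : ∀ ρ ∈ partnerPerms S, slotPerm ρ s ∈ InRegG (slotSign L α) S := by
    refine forall_slotPerm_mem_inRegG_of_injective (slotSign L α) S fun w hw hind => ?_
    have hne : w ≠ w₀ := by rintro rfl; exact hdef hind
    exact hreg w hw hne
  obtain ⟨hev, -⟩ := eventually_nhdsNE_mem_regG_add_smul_nrm hw₀ hs02 hs1 hreg hx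
  have hI1 : ContDiffOn ℝ ∞ (F S) (InRegG (slotSign L α) S) := (hF.2.2.1 S).1
  -- the resolved product is continuous through `ν = 0`
  have hc : Continuous fun ν : ℝ => s + ν • nrm w₀ := continuous_const.add (continuous_id.smul continuous_const)
  have hcU : Continuous fun ν : ℝ => partnerWeight L α S *
      ∏ w : {w : InfinitePlace L // IsComplex w}, (if w ∈ S then Complex.exp (((2 * k w + 1 : ℤ) : ℂ) * (((s + ν • nrm w₀) w 2 : ℂ) * I))
        else (((Circle.exp ((s + ν • nrm w₀) w 0) : ℂ) * Circle.exp ((s + ν • nrm w₀) w 2)) ^ (k w)) * (Circle.exp ((s + ν • nrm w₀) w 2) : ℂ)) :=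
    continuous_const.mul ((contDiff_unit S k).continuous.comp hc)
  have hsumc : Tendsto (fun ν : ℝ => ∑ ρ ∈ partnerPerms S,
      (((∏ w : {w : InfinitePlace L // IsComplex w},
          ((SignType.sign ((w.1.embedding (α (lineOf (formSign L α w) ((ρ w).symm 1)))).re) : ℤ) * archMajoritySign L (Matrix.diagonal α) w) : ℤ) : ℂ) *
        ∏ w : {w : InfinitePlace L // IsComplex w}, (Equiv.Perm.sign (ρ w) : ℂ)) *
      (archERhoG S (slotPerm ρ (s + ν • nrm w₀)) * F S (slotPerm ρ (s + ν • nrm w₀)))) (𝓝 (0 : ℝ))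
      (𝓝 (∑ ρ ∈ partnerPerms S,
        (((∏ w : {w : InfinitePlace L // IsComplex w},
            ((SignType.sign ((w.1.embedding (α (lineOf (formSign L α w) ((ρ w).symm 1)))).re) : ℤ) * archMajoritySign L (Matrix.diagonal α) w) : ℤ) : ℂ) *
          ∏ w : {w : InfinitePlace L // IsComplex w}, (Equiv.Perm.sign (ρ w) : ℂ)) *
        (archERhoG S (slotPerm ρ s) * F S (slotPerm ρ s)))) :=
    tendsto_finsetSum _ fun ρ hρ => (tendsto_twisted_slotPerm_add_smul_nrm L α hI1 ρ (htame ρ hρ) w₀).const_mul _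
  have hprod := (hcU.tendsto 0).mul hsumc
  refine hasOneSidedJump_congr_eventuallyEq (hasOneSidedJump_zero_of_tendsto hprod) ?_
  filter_upwards [hev] with ν hν
  rw [transfFam_of_mem_regG L α μ F S hν, transfFamReg_eq_unit_mul_sum L α μ hS F k (hk S) hν]

/-- **(I₃) AT ORDER `0` AT EVERY COMPACT WALL OF EVERY CHART** (house frame `α_i ≠ 0` real at all places, `μ`-guard): for ANY chart `S`, compact place `w₀ ∉ S` and `G`-semiregular
point `s` of the `H`-wall at `w₀`, `ν ↦ transfFam L α μ F S (s + ν • nrm w₀)` has both one-sided limits at `0` and jumps by `2 · jc′ S w₀ 0 2 · transfFam L α μ F (insert w₀ S) (cayPt w₀ s)`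
— the covered case is §7, the uncovered and inadmissible cases are the zero branches above (both sides `0`). [cite: Shelstad1979, Thm. 4.7 (IIIb) p. 31]
[cite: Bouaziz1994IntegralesOrbitales, §3.2 (I₃) p. 580; Rem. 2 p. 594] [cite: Rogawski1990, §4.3 (4.3.1) p. 43; §14.2 p. 232] -/
theorem transfFam_hasOneSidedJump_order_zero_all (hα : ∀ i, α i ≠ 0)
    (hreal : ∀ (w : {w : InfinitePlace L // IsComplex w}) (i : Fin 3), (w.1.embedding (α i)).im = 0)
    (hμω : ∀ x : ideleGroup ↥(maximalRealSubfield L), μ (AdeleRing.ideleBaseChange (↥(maximalRealSubfield L)) L x) = quadraticHeckeCharCM L x)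
    {S : Finset {w : InfinitePlace L // IsComplex w}} {w₀ : {w : InfinitePlace L // IsComplex w}} (hw₀ : w₀ ∉ S)
    {jc' : Finset {w : InfinitePlace L // IsComplex w} → {w : InfinitePlace L // IsComplex w} → Fin 3 → Fin 3 → ℂ}
    {F : Finset {w : InfinitePlace L // IsComplex w} → ({w : InfinitePlace L // IsComplex w} → Fin 3 → ℝ) → ℂ} (hF : ArchHCSpaceG (slotSign L α) jc' F)
    {s : {w : InfinitePlace L // IsComplex w} → Fin 3 → ℝ} (hs02 : s w₀ 0 = s w₀ 2) (hs1 : Circle.exp (s w₀ 1) ≠ Circle.exp (s w₀ 0))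
    (hreg : ∀ v, v ∉ S → v ≠ w₀ → Function.Injective fun i : Fin 3 => Circle.exp (s v i)) (hx : ∀ v ∈ S, s v 0 ≠ 0) :
    HasOneSidedJump (fun ν : ℝ => transfFam L α μ F S (s + ν • nrm w₀)) (2 * jc' S w₀ 0 2 * transfFam L α μ F (insert w₀ S) (cayPt w₀ s)) := by
  by_cases hS : ∀ w, w ∈ S → w ∈ splitChartPlaces L α
  · by_cases hcov : w₀ ∈ splitChartPlaces L α
    · exact transfFam_hasOneSidedJump_order_zero L α μ hα hμω hS hw₀ hcov hF hs02 hs1 hreg hx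
    · exact transfFam_hasOneSidedJump_order_zero_of_not_mem_splitChartPlaces L α μ hα hreal hμω hS hw₀ hcov hF hs02 hs1 hreg hx
  · exact transfFam_hasOneSidedJump_order_zero_of_not_admissible L α μ hS w₀ jc' F s

end Zero

end Literature.NumberTheory.Rogawski1990

end
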